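import Summits.PneNP.PneNP.Theorems.SmallBlockRothvossBound
import Summits.PneNP.MatchingPsdRank.Conjectures.MatchingSmallBlockPsdBound
import HarnessLib

/-!
# Cell pnp-psdrank, T-SOC (`SmallBlockRothvoss`): the rung leaf `MatchingSmallBlockPsdBound`, closed by name

`Summit.PneNP.MatchingPsdRank.MatchingSmallBlockPsdBound` (rung F-N2.SOC of the pnp-psdrank ladder; lit's Conjectures
module, body = planner p2's leaf-R4 over the tree vocabulary `Literature.Combinatorics.Optimization.HasBlockPsdFactorization`):
second-order-cone (`(S²₊)^m`) lifts of the perfect matching polytope of `K_n` have `m ≥ 2^{α n}` for all even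
`n ≥ n₀` (`α = δ_R/6384`). The statement is literally `matchingSmallBlockPsdBound_explicit`
(file SmallBlockRothvossBound; eng g3's SocLift.lean, referee g13 PASS), so the closer is definitional.
WHAT THIS IS NOT: not a bound for general psd lifts (the FGPRT question stays open); exact lifts only; nothing on P vs NP.
-/

set_option linter.dupNamespace false -- `Summit.PneNP.PneNP.…`: summit = sub-problem (D-0017)

namespace Summit.PneNP.PneNP.Theorems.SmallBlockRothvoss

/-- **Rung leaf F-N2.SOC, by name**: `(S²₊)^m`-lifts (second-order-cone lifts) of `P_PM(n)` have `m ≥ 2^{Ω(n)}`. -/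
theorem MatchingSmallBlockPsdBound_proof : Summit.PneNP.MatchingPsdRank.MatchingSmallBlockPsdBound :=
  matchingSmallBlockPsdBound_explicit

end Summit.PneNP.PneNP.Theorems.SmallBlockRothvoss
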